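import Summits.QuantumFields.YangMills.Theorems.LuscherReductionTwistedTraceScalingRecordShadow
import Summits.QuantumFields.YangMills.Theorems.LuscherReductionTwistedTraceScalingFPWeightOrbitRep
import Summits.QuantumFields.YangMills.Theorems.LuscherReductionTwistedTraceScalingBTWindow
import HarnessLib

/-!
# The support of the record weight, eventually: links and slow mean in explicit `β^{-s}` windows, chart coverage, slow action `≤ β^{-2s}`
# (lane A of S-BASE, crux `TwistedTraceScaling` stmt-QuantumFields-20203, C4-CORE, the (OD) pen; `pub/ym-fleet/ym-luscher-20007-p1/COARSE-DESIGN.md` §30.5)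

The (B-OD) defect `E = 𝟙_S·(K̃(φ⊗Ω)/w − ψ⊗Ω)` lives on `S = {recordChi L s 43 M β ≠ 0}` (the record fat tube: every link within `43Mβ^{-s}` of `1` in Frobenius norm,
`orbitDist < 43β^{-s}`).  This file records, ONCE, what every region estimate needs about a point of `S`, eventually in `β` (`s > 0`, `M ≥ 0`):
★★ `recordChi_support` —
* `‖q(U_e) − 1‖ ≤ 43Mβ^{-s}` for every edge and `orbitDist U < 43β^{-s}`;
* `U ∈ orthoTubeSet L` (the orthographic chart `U = oT (slowMean U) v` covers `S`: `…OrthoTubeCoverage.mem_orthoTubeSet_of_near_one`);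
* the slow mean is in the window `‖q((slowMean U)_k) − 1‖ ≤ 517·β^{-s}/|Site|` (slow shadow `…SlowShadow.orbitDist_slowMean_le`, `12·43 + 1 = 517`) and has
  one-site action `L³·S(slowMean U) ≤ β^{-2s}` (`…BTWindow.wilsonAction_one_site_le`: `S ≤ 12δ⁴`).
So the slow window `{‖q(u_k) − 1‖ ≤ Dβ^{-s}, L³S(u) ≤ β^{-2s}}` of the (C4)-core estimate with `D = 517/|Site|` contains the slow mean of EVERY point of `S` (the set
`S ∖ S_in` of the core estimate has no "slow-far" part), for every `M`.
HONEST FRAMING: bookkeeping for a stub of a child of the CONDITIONAL route R2b1; (C5), the final `b`, (B-ST), C4-CORE OPEN; not a gap, not Clay.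
-/

set_option autoImplicit false

noncomputable section

open MeasureTheory Filter Topology Real
open scoped BigOperators Matrix Quaternion
open Literature.MathematicalPhysics.QuantumFieldTheory
open Literature.MathematicalPhysics.QuantumLattice

namespace Summit.QuantumFields.YangMills.Theorems.FemtoTransferGap.TwoLattice.ConstTube

open Summit.QuantumFields.YangMills.Theorems.FemtoTransferGap
open Summit.QuantumFields.YangMills.Theorems.FemtoTransferGap.TwoLattice
open Summit.QuantumFields.YangMills.Theorems.FemtoTransferGap.TwoLattice.Avg

variable {L : ℕ} [NeZero L]

/-- ★★ **THE SUPPORT OF THE RECORD WEIGHT, eventually in `β`** (`s > 0`, `M ≥ 0`): every `U` with `recordChi L s 43 M β U ≠ 0` has all links within `43Mβ^{-s}` of `1`,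
`orbitDist U < 43β^{-s}`, lies in `orthoTubeSet L`, and its slow mean satisfies `‖q((slowMean U)_k) − 1‖ ≤ 517β^{-s}/|Site|` and `L³·S(slowMean U) ≤ β^{-2s}`.
[cite: Luscher1983, §3] -/
theorem recordChi_support {s : ℝ} (hs : 0 < s) {M : ℝ} (hM : 0 ≤ M) :
    ∀ᶠ β : ℝ in atTop, ∀ U : GaugeConfig 3 L SU2, recordChi L s 43 M β U ≠ 0 →
      (∀ e : Edge 3 L, ‖su2Quat (U e) - 1‖ ≤ M * (43 * powScale s β)) ∧ orbitDist U < 43 * powScale s β ∧ U ∈ orthoTubeSet L ∧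
        (∀ k : Fin 3, ‖su2Quat (slowMean L U (0, k)) - 1‖ ≤ 517 / Fintype.card (Site 3 L) * powScale s β) ∧
        (L : ℝ) ^ 3 * wilsonAction su2Rep (slowMean L U) ≤ powScale (2 * s) β := by
  set N : ℝ := (Fintype.card (Site 3 L) : ℝ) with hNdef
  have hN : 0 < N := by rw [hNdef]; exact_mod_cast Fintype.card_pos
  have hN1 : 1 ≤ N := by rw [hNdef]; exact_mod_cast Fintype.card_pos
  have hL1 : (1 : ℝ) ≤ L := by exact_mod_cast NeZero.one_le
  have hδt := tendsto_powScale hs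
  have hδ2t : Tendsto (powScale (2 * s)) atTop (𝓝 0) := tendsto_powScale (by linarith)
  -- the four eventual smallness conditions
  have c1 : (0 : ℝ) < 1 / (50 * (43 * (M + 1)) ^ 2) := by positivity
  have c2 : (0 : ℝ) < 1 / (36 * L * N * (43 * (M + 1)) ^ 2) := by positivity
  have c3 : (0 : ℝ) < 1 / (12 * (L : ℝ) ^ 3 * (517 / N) ^ 4 + 1) := by positivity
  filter_upwards [hδt.eventually (gt_mem_nhds c1), hδt.eventually (gt_mem_nhds c2), hδt.eventually (gt_mem_nhds (show (0 : ℝ) < 1 / 100 by norm_num)),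
    hδ2t.eventually (gt_mem_nhds c3)] with β hβ1 hβ2 hβ3 hβ4 U hU
  set δ : ℝ := powScale s β with hδdef
  have hδ0 : 0 < δ := powScale_pos s β
  obtain ⟨-, hmem⟩ := (recordChi_props (L := L) s 43 M β).2.2.2 U hU
  have hnear : U ∈ nearOne L (M * (43 * δ)) := hmem.1
  have hod : orbitDist U < 43 * δ := hmem.2
  have hρ0 : 0 ≤ M * (43 * δ) := by positivity
  -- links
  have hlink : ∀ e : Edge 3 L, ‖su2Quat (U e) - 1‖ ≤ M * (43 * δ) := fun e => by
    have h := norm_su2Quat_sub_le (U e) 1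
    rw [su2Quat_one, OneMemClass.coe_one] at h
    exact h.trans (hnear e).le
  -- chart coverage
  have hρ1 : M * (43 * δ) ≤ 43 * (M + 1) * δ := by nlinarith
  have hρsq : (M * (43 * δ)) ^ 2 / 4 ≤ 1 / 50 := by
    have h1 : (M * (43 * δ)) ^ 2 ≤ (43 * (M + 1) * δ) ^ 2 := pow_le_pow_left₀ hρ0 hρ1 2
    have h2 : (43 * (M + 1)) ^ 2 * δ < 1 / 50 := by
      have := (lt_div_iff₀ (by positivity : (0 : ℝ) < 50 * (43 * (M + 1)) ^ 2)).mp hβ1; linarith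
    have h3 : (43 * (M + 1) * δ) ^ 2 = ((43 * (M + 1)) ^ 2 * δ) * δ := by ring
    have hδ1 : δ ≤ 1 := powScale_le_one hs.le β
    nlinarith [mul_le_mul_of_nonneg_left hδ1 (by positivity : (0 : ℝ) ≤ (43 * (M + 1)) ^ 2 * δ)]
  have hsc : ∀ e : Edge 3 L, 1 - (M * (43 * δ)) ^ 2 / 4 ≤ scalarPart (U e) := fun e => scalarPart_ge_of_frobNorm_le (hnear e).le
  have hOT : U ∈ orthoTubeSet L := (mem_orthoTubeSet_of_near_one L (by positivity) hρsq hsc).2.1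
  -- slow shadow
  have hq : 3 * L * N * (M * (43 * δ) + 43 * δ) ^ 2 ≤ δ / 12 := by
    have e : 3 * L * N * (M * (43 * δ) + 43 * δ) ^ 2 = (3 * L * N * (43 * (M + 1)) ^ 2 * δ) * δ := by ring
    rw [e]
    have h1 : 3 * L * N * (43 * (M + 1)) ^ 2 * δ ≤ 1 / 12 := by
      have := (lt_div_iff₀ (by positivity : (0 : ℝ) < 36 * L * N * (43 * (M + 1)) ^ 2)).mp hβ2
      nlinarith
    have := mul_le_mul_of_nonneg_right h1 hδ0.le
    linarith
  have hsmall : 43 * δ + 3 * L * N * (M * (43 * δ) + 43 * δ) ^ 2 < N / 2 := by nlinarith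
  have hshadow := orbitDist_slowMean_le hnear hod hsmall
  have hsm : orbitDist (slowMean L U) ≤ 517 / N * δ := by
    calc orbitDist (slowMean L U) ≤ 12 * (43 * δ + 3 * L * N * (M * (43 * δ) + 43 * δ) ^ 2) / N := hshadow
      _ ≤ 12 * (43 * δ + δ / 12) / N := by gcongr
      _ = 517 / N * δ := by ring
  have hslow : ∀ k : Fin 3, ‖su2Quat (slowMean L U (0, k)) - 1‖ ≤ 517 / N * δ := fun k =>
    (norm_su2Quat_sub_one_le_orbitDist (slowMean L U) (0, k)).trans hsm
  -- slow action
  have hS := wilsonAction_one_site_le (slowMean L U) (δ := 517 / N * δ) fun e => by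
    have : e = (0, e.2) := by ext <;> simp [Subsingleton.elim e.1 0]
    rw [this]; exact hslow e.2
  have hmul : powScale s β * powScale s β = powScale (2 * s) β := by
    unfold powScale
    have h0 : 0 < max β 1 := lt_of_lt_of_le one_pos (le_max_right _ _)
    rw [← Real.rpow_add h0]; ring_nf
  have hδ4 : δ ^ 4 = powScale (2 * s) β * powScale (2 * s) β := by
    rw [hδdef, ← hmul]; ring
  have hps2 : 0 < powScale (2 * s) β := powScale_pos _ _
  have hact : (L : ℝ) ^ 3 * wilsonAction su2Rep (slowMean L U) ≤ powScale (2 * s) β := by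
    have h1 : (L : ℝ) ^ 3 * wilsonAction su2Rep (slowMean L U) ≤ (L : ℝ) ^ 3 * (12 * (517 / N * δ) ^ 4) := mul_le_mul_of_nonneg_left hS (by positivity)
    have h2 : (L : ℝ) ^ 3 * (12 * (517 / N * δ) ^ 4) = (12 * (L : ℝ) ^ 3 * (517 / N) ^ 4 * powScale (2 * s) β) * powScale (2 * s) β := by
      rw [mul_pow, hδ4]; ring
    have h3 : 12 * (L : ℝ) ^ 3 * (517 / N) ^ 4 * powScale (2 * s) β ≤ 1 := by
      have := (lt_div_iff₀ (by positivity : (0 : ℝ) < 12 * (L : ℝ) ^ 3 * (517 / N) ^ 4 + 1)).mp hβ4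
      nlinarith
    calc (L : ℝ) ^ 3 * wilsonAction su2Rep (slowMean L U) ≤ (12 * (L : ℝ) ^ 3 * (517 / N) ^ 4 * powScale (2 * s) β) * powScale (2 * s) β := h1.trans_eq h2
      _ ≤ 1 * powScale (2 * s) β := mul_le_mul_of_nonneg_right h3 hps2.le
      _ = powScale (2 * s) β := one_mul _
  exact ⟨hlink, hod, hOT, hslow, hact⟩

end Summit.QuantumFields.YangMills.Theorems.FemtoTransferGap.TwoLattice.ConstTube

end
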